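import Summits.CriticalPhenomena.PercolationContinuityZ3.Theorems.SahiAEAffiliation
import Summits.CriticalPhenomena.PercolationContinuityZ3.Theorems.SahiBoxTP2Real
import Literature.Probability.LatticeModels.MTP2WeakClosure

/-!
# Box-TP₂ laws with a density: the four-way equivalence, and Sahi positivity for a.e.-pair MTP₂ densities on `ℝ^d`

Support file of the Sahi cell (`prim-sahi`, typer seat, generation 19; `--supports stmt-CriticalPhenomena-4575`).
Theorems only (no definitions, no named facts, no sorries).

The cell's positivity theorems for box-TP₂ laws on `ℝ^d` (`SahiBoxTP2Real.lean`, generation 11) were fed, for laws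
with a density, by `IsBoxTP2.withDensity_pi`, which needs the MTP₂ inequality of the density at EVERY pair.  With
`isBoxTP2_withDensity_pi_of_ae` (the almost-everywhere four functions theorem) the same conclusions hold for densities
that are MTP₂ on ALMOST EVERY PAIR — the intrinsic condition (independent of the version of the density; equivalent to
set-TP₂ / affiliation of the law, `mIsSetTP2_withDensity_pi_iff_ae`):

* `isBoxTP2_iff_cmsCondC'` — the cell's `IsBoxTP2` IS Colangelo–Müller–Scarsini's condition (c′) of the tree
  (`CMSCondC'`, `MTP2WeakClosure.lean`), `Iff.rfl`; hence, for every FINITE measure on `ℝ^ι`, box-TP₂ ⟺ set-TP₂ ⟺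
  affiliated by the tree's `mIsSetTP2_iff_cmsCondC'`, `mIsSetTP2_iff_mIsAffiliated_pi` (`isBoxTP2_iff_mIsSetTP2_pi`,
  `isBoxTP2_iff_mIsAffiliated_pi`; the cell had these on the compact cube `Q_d`, `SahiBoxTP2Affiliation(Converse)`).
* **`isBoxTP2_withDensity_pi_iff_ae`** — for `π = ⊗ᵢ ρᵢ` locally finite and `∫ f dπ < ∞`: `π·f` is box-TP₂ ⟺ `f` is
  MTP₂ on `π ⊗ π`-almost every pair.  Together with `SahiAEAffiliation.lean`: **box-TP₂ ⟺ set-TP₂ ⟺ affiliated ⟺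
  a.e.-pair MTP₂ density**, for every law with a density w.r.t. a product of locally finite measures on `ℝ^ι`.
* `msahiE_nonneg_of_ae_mtp2_density` — `LiebSahiContinuum d n` ⟹ `E_n(f₁,…,f_n) ≥ 0` under `(∏μᵢ)·ρ` for every
  probability density `ρ` a.e.-pair MTP₂ w.r.t. any product of σ-finite measures on `ℝ^d` and all bounded measurable
  nonnegative monotone families;
* `msahiE_nonneg_of_ae_mtp2_density_of_le_two` (`d ≤ 2`, every order, unconditional) and
  `msahiE_nonneg_of_ae_mtp2_density_of_order_le_two` (`n ≤ 2`, every `d`: the FKG inequality), unconditional.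
  (Order 3 in `d ≤ 3` follows in the same way from the computational `SahiBoxTP2GridThree` layer; not restated here to
  keep this file free of the certificate's axiom footprint.)

No sorries, no new axioms.
-/

noncomputable section

namespace Summit.CriticalPhenomena.PercolationContinuityZ3.Theorems.SahiAEFourFunctions

open MeasureTheory Set Filter Literature.Combinatorics.Sahi2008
open Literature.Probability.LatticeModels Literature.Probability.LatticeModels.Affiliation
open Summit.CriticalPhenomena.PercolationContinuityZ3.Theorems.SahiBoxTP2
open scoped ENNReal

/-! ### Box-TP₂ on `ℝ^ι`: the density-free equivalences of the tree, and the a.e.-pair density criterion -/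

section Equivalences

variable {ι : Type*} [Fintype ι]

omit [Fintype ι] in
/-- The cell's `IsBoxTP2` is Colangelo–Müller–Scarsini's condition (c′) (`CMSCondC'`) — same body. [folklore] -/
theorem isBoxTP2_iff_cmsCondC' {Ω : Type*} [Lattice Ω] [MeasurableSpace Ω] (μ : Measure Ω) :
    IsBoxTP2 μ ↔ CMSCondC' μ :=
  Iff.rfl

/-- **Box-TP₂ ⟺ set-TP₂ for every finite measure on `ℝ^ι`** (the tree's CMS Theorem 1 (a) ⟺ (c′),
`mIsSetTP2_iff_cmsCondC'`, in the cell's vocabulary). [folklore] -/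
theorem isBoxTP2_iff_mIsSetTP2_pi (μ : Measure (ι → ℝ)) [IsFiniteMeasure μ] : IsBoxTP2 μ ↔ mIsSetTP2 μ :=
  (mIsSetTP2_iff_cmsCondC' μ).symm

/-- **Box-TP₂ ⟺ affiliated for every finite measure on `ℝ^ι`** (the tree's `cmsCondC'_iff_mIsAffiliated`). [folklore] -/
theorem isBoxTP2_iff_mIsAffiliated_pi (μ : Measure (ι → ℝ)) [IsFiniteMeasure μ] : IsBoxTP2 μ ↔ mIsAffiliated μ :=
  cmsCondC'_iff_mIsAffiliated μ

/-- **Box-TP₂ ⟺ a.e.-pair MTP₂ density**: for `π = ⊗ᵢ ρᵢ` (locally finite `ρᵢ` on `ℝ`) and a measurable `f` with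
`∫ f dπ < ∞`, the law `π·f` is box-TP₂ if and only if `f(x) f(y) ≤ f(x ∧ y) f(x ∨ y)` for `π ⊗ π`-almost every
`(x, y)`.  (⟹: box ⟹ set-TP₂ (CMS Thm 1) ⟹ a.e. pair (literature seat's Besicovitch argument); ⟸: the a.e. four
functions theorem.) [this work] -/
theorem isBoxTP2_withDensity_pi_iff_ae (ρ : ι → Measure ℝ) [∀ i, IsLocallyFiniteMeasure (ρ i)]
    (f : (ι → ℝ) → ℝ≥0∞) (hf : Measurable f) (hfin : ∫⁻ z, f z ∂Measure.pi ρ ≠ ∞) :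
    IsBoxTP2 ((Measure.pi ρ).withDensity f) ↔
      ∀ᵐ p ∂(Measure.pi ρ).prod (Measure.pi ρ), f p.1 * f p.2 ≤ f (p.1 ⊓ p.2) * f (p.1 ⊔ p.2) := by
  haveI : IsFiniteMeasure ((Measure.pi ρ).withDensity f) := isFiniteMeasure_withDensity hfin
  exact ⟨fun h => ae_pair_latticeCondition_of_mIsSetTP2 ρ f hf hfin ((isBoxTP2_iff_mIsSetTP2_pi _).1 h),
    isBoxTP2_withDensity_pi_of_ae ρ f hf⟩

end Equivalences

/-! ### Sahi positivity for a.e.-pair MTP₂ densities on `ℝ^d` -/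

variable {d n : ℕ}

/-- **Sahi positivity of order `n` for a.e.-pair MTP₂ densities on `ℝ^d`, given the continuum statement
`LiebSahiContinuum d n`**: for σ-finite `μᵢ`, a measurable `ρ : ℝ^d → [0,∞]` with
`ρ(x) ρ(y) ≤ ρ(x ∧ y) ρ(x ∨ y)` for `(∏μᵢ) ⊗ (∏μᵢ)`-a.e. `(x,y)` and `(∏μᵢ)·ρ` a probability measure, and every
bounded measurable nonnegative coordinatewise non-decreasing family `f₁,…,f_n`, `E_n(f) ≥ 0`. [this work] -/
theorem msahiE_nonneg_of_ae_mtp2_density (h : LiebSahiContinuum d n) (μ : Fin d → Measure ℝ)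
    [∀ i, SigmaFinite (μ i)] (ρ : (Fin d → ℝ) → ℝ≥0∞) (hρm : Measurable ρ)
    (hρ : ∀ᵐ p ∂(Measure.pi μ).prod (Measure.pi μ), ρ p.1 * ρ p.2 ≤ ρ (p.1 ⊓ p.2) * ρ (p.1 ⊔ p.2))
    [IsProbabilityMeasure ((Measure.pi μ).withDensity ρ)] (f : Fin n → (Fin d → ℝ) → ℝ)
    (hfm : ∀ i, Measurable (f i)) (hf0 : ∀ i x, 0 ≤ f i x) {M : ℝ} (hfM : ∀ i x, f i x ≤ M)
    (hmono : ∀ i, Monotone (f i)) : 0 ≤ msahiE ((Measure.pi μ).withDensity ρ) n f :=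
  msahiE_nonneg_of_isBoxTP2_real h _ (isBoxTP2_withDensity_pi_of_ae μ ρ hρm hρ) f hfm hf0 hfM hmono

/-- **Unconditionally in dimension `d ≤ 2`**: every a.e.-pair MTP₂ probability density on `ℝ` or `ℝ²` (any product
reference measure) is Sahi-positive of EVERY order for bounded measurable nonnegative monotone families. [this work] -/
theorem msahiE_nonneg_of_ae_mtp2_density_of_le_two (hd : d ≤ 2) (μ : Fin d → Measure ℝ)
    [∀ i, SigmaFinite (μ i)] (ρ : (Fin d → ℝ) → ℝ≥0∞) (hρm : Measurable ρ)
    (hρ : ∀ᵐ p ∂(Measure.pi μ).prod (Measure.pi μ), ρ p.1 * ρ p.2 ≤ ρ (p.1 ⊓ p.2) * ρ (p.1 ⊔ p.2))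
    [IsProbabilityMeasure ((Measure.pi μ).withDensity ρ)] (n : ℕ) (f : Fin n → (Fin d → ℝ) → ℝ)
    (hfm : ∀ i, Measurable (f i)) (hf0 : ∀ i x, 0 ≤ f i x) {M : ℝ} (hfM : ∀ i x, f i x ≤ M)
    (hmono : ∀ i, Monotone (f i)) : 0 ≤ msahiE ((Measure.pi μ).withDensity ρ) n f :=
  msahiE_nonneg_of_isBoxTP2_real_of_le_two hd _ (isBoxTP2_withDensity_pi_of_ae μ ρ hρm hρ) n f hfm hf0 hfM hmono

/-- **Unconditionally for order `n ≤ 2` (the FKG inequality in Sahi's normalisation)**: every a.e.-pair MTP₂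
probability density on `ℝ^d` gives `E_n(f) ≥ 0`, `n ≤ 2`, for bounded measurable nonnegative monotone families.
[this work] -/
theorem msahiE_nonneg_of_ae_mtp2_density_of_order_le_two (hn : n ≤ 2) (μ : Fin d → Measure ℝ)
    [∀ i, SigmaFinite (μ i)] (ρ : (Fin d → ℝ) → ℝ≥0∞) (hρm : Measurable ρ)
    (hρ : ∀ᵐ p ∂(Measure.pi μ).prod (Measure.pi μ), ρ p.1 * ρ p.2 ≤ ρ (p.1 ⊓ p.2) * ρ (p.1 ⊔ p.2))
    [IsProbabilityMeasure ((Measure.pi μ).withDensity ρ)] (f : Fin n → (Fin d → ℝ) → ℝ)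
    (hfm : ∀ i, Measurable (f i)) (hf0 : ∀ i x, 0 ≤ f i x) {M : ℝ} (hfM : ∀ i x, f i x ≤ M)
    (hmono : ∀ i, Monotone (f i)) : 0 ≤ msahiE ((Measure.pi μ).withDensity ρ) n f :=
  msahiE_nonneg_of_isBoxTP2_real_of_order_le_two hn _ (isBoxTP2_withDensity_pi_of_ae μ ρ hρm hρ) f hfm hf0 hfM
    hmono

end Summit.CriticalPhenomena.PercolationContinuityZ3.Theorems.SahiAEFourFunctions
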